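import Mathlib.CategoryTheory.Limits.Shapes.WidePullbacks
import Mathlib.CategoryTheory.Limits.Connected
import Literature.AnabelianGeometry.EtaleTheta.FrdIVocabulary
import Literature.AnabelianGeometry.EtaleTheta.Discharge.Sec4NonVacuity
import Literature.AnabelianGeometry.EtaleTheta.Discharge.Sec4Remark411
import HarnessLib

/-!
# [EtTh] Remark 4.1.1 (`BiKummerSetting.Remark411`): conjunct (1) at the canonical category vocabulary, and the
# (negative) universal closure — a morphism of base-Frobenius type over a span-shaped base is NOT a categorical
# quotient (schema certificate; consistency witness with a non-trivial base category)

S. Mochizuki, *The étale theta function and its Frobenioid-theoretic manifestations*, Publ. RIMS **45**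
(2009), §4, Remark 4.1.1, printed p. 314 (PDF p. 88) [cite: MochizukiEtTh2009, Rmk 4.1.1 p.88]: "if `α : A → B`
is of base-Frobenius type, then by applying Proposition 3.4, (ii), together with the factorization of [FrdI],
Definition 1.3, (iv), (a), one verifies easily that `A → B` is a categorical quotient [cf. [FrdI], §0] of `A` by the
subgroup `G · μ_N(A) ⊆ Aut_C(A)` in the full subcategory of `C` determined by the Frobenius-trivial objects
[cf. [FrdI], Theorem 5.1, (iii)]."

WITNESS + PROOF file next to `BiKummer.lean` (statements, seat abc-iut-L2-t3) and `Discharge/Sec4Remark411.lean`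
(abc-iut-L6-t12: conjunct (1) `remark411_actsOver`), abc-iut cell, block F (fact-proving wave), seat abc-iut-f-108,
FACT-LIST row **F-0729** `BiKummerSetting.Remark411`.  The named `Prop` is typed over the HYPOTHESIS STRUCTURE
`S : BiKummerSetting X T D VD`, whose base category `D` is an ARBITRARY (connected, totally epimorphic) category:
print's `D = B^temp(X^log)⁰[D]` and the categorical-quotient property of Galois objects in it — [EtTh] Prop. 3.4 (ii),
the one ingredient of the printed verification that is about `D` — are not carried by the structure (abc-iut-L6-t12's
diagnosis in `Sec4Remark411.lean`).  This file makes that diagnosis a kernel fact: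

* **Instance form (conjunct (1)) with no residual hypothesis**: for a setting typed at the CANONICAL [FrdI] category
  vocabulary `treeCatVocab` (`FrdIVocabulary.lean`: "divisorial monoid on `D`" := the tree's notion), the hypothesis
  "`Φ` divisorial" of `remark411_actsOver` is the interface field `TemperedFrobenioid.isDivisorialOn`
  (`remark411_actsOver_treeCatVocab`); likewise at the perfect toy (`Toy.remark411_actsOver`).
* **The universal closure is FALSE, even along the canonical model instances `mkOfModelCanonical`**: over the
  span-shaped base category `b ← a → x` (`WidePushoutShape Bool`: connected, totally epimorphic, skeletal, all
  automorphism groups trivial) carry the perfect toy's divisor data (`Φ = ℚ_{≥0}`, `B = ℤ ×_{(ℚ_{≥0})^gp} (ℚ_{≥0})^gp`,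
  constant along the base); in the resulting tempered-Frobenioid interface (`Toy.temperedFrobenioidSpan`) and its
  canonical §4 setting (`Toy.biKummerSettingSpan`, through abc-iut-L2-t9's `mkOfModelCanonical`, `A_⊙ := (a, 0)`), the
  linear isometry `α := (1, a → b, 0, 1) : (a, 0) → (b, 0)` IS of base-Frobenius type — `G = 1`, `α'' = id`, `α' = α`,
  `N = 1`, condition (e) being the REAL [FrdI] Def. 2.7 (iii) predicate witnessed by the zero section
  (`ModelFrobenioid.isBaseFrobeniusPair_zero`) — yet the morphism `ψ := (1, a → x, 0, 1) : (a, 0) → (x, 0)` to the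
  Frobenius-trivial object `(x, 0)` is (vacuously) `G · μ_1`-invariant and does NOT factor through `α`, there being no
  arrow `b → x` in the base: `Toy.not_remark411_span`, `not_forall_remark411`, `not_forall_remark411_mkOfModelCanonical`.

So the row is a SCHEMA whose instance forms must constrain the BASE CATEGORY (print: a connected temperoid, where
a morphism out of a Galois object is a categorical quotient by its Galois group, [EtTh] Prop. 3.4 (ii) /
[SemiAnbd] §3); it is never the hypothesis `∀ S, S.Remark411`.  Nothing in print is refuted (print's `D` is not a
span); no statement of the paper is restated or strengthened; the `def`s below are toy DATA (no `Prop`-valued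
definition, no named fact, no instance, no `sorry`).  HONEST FRAMING: consistency/independence witness for a typed
interface; typed ≠ proved; nothing here bears on, or takes a side on, [IUTchIII] Cor. 3.12.
-/

noncomputable section

namespace Literature.AnabelianGeometry.EtaleTheta

open CategoryTheory Opposite Limits Literature.AlgebraicGeometry.Frobenioids
open scoped NNRat

universe u₀ v₀ u v w

/-! ### Instance form: conjunct (1) of Remark 4.1.1 at the canonical [FrdI] category vocabulary -/

namespace BiKummerSetting

variable {K : Type u₀} [Field K] {X : SemiGraphs.TemperedArithmeticGroup.{u₀} K} {D₀ : Type u₀} [Category.{v₀} D₀]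
  {V : FrdIMonoidStub.{w}} {T : RealifiedDivisorMonoids (D₀ := D₀) V} {D : Type u} [Category.{v} D]
  {IR ISR : (Dᵒᵖ ⥤ CommMonCat.{w}) → Prop} (S : BiKummerSetting X T D (treeCatVocab D IR ISR))

/-- **Remark 4.1.1, conjunct (1), at the canonical category vocabulary — no residual hypothesis**: for a §4 setting
whose tempered Frobenioid is typed at `treeCatVocab` ("`Φ` … determines a … divisorial monoid on `D`" read by the
tree's `IsMonoidOn ∧ Objectwise IsDivisorial`), the subgroup `G · μ_N(A)` acts over every morphism of base-Frobenius
type (abc-iut-L6-t12's `remark411_actsOver`, its hypothesis supplied by the field `tf.isDivisorialOn`).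
[cite: MochizukiEtTh2009, Rmk 4.1.1 p.88] -/
theorem remark411_actsOver_treeCatVocab {A B : S.C} (α : A ⟶ B) (d : S.BaseFrobeniusTypeData α) :
    ∀ γ ∈ d.G ⊔ Subgroup.closure (S.mu A (S.degFr α)), γ.hom ≫ α = α :=
  S.remark411_actsOver S.tf.isDivisorialOn.2 α d

end BiKummerSetting

namespace Toy

/-- Conjunct (1) of Remark 4.1.1 HOLDS at the perfect toy setting (`Φ = ℚ_{≥0}` divisorial).
[cite: MochizukiEtTh2009, Rmk 4.1.1 p.88] -/
theorem remark411_actsOver {A B : biKummerSetting.C} (α : A ⟶ B) (d : biKummerSetting.BaseFrobeniusTypeData α) :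
    ∀ γ ∈ d.G ⊔ Subgroup.closure (biKummerSetting.mu A (biKummerSetting.degFr α)), γ.hom ≫ α = α :=
  biKummerSetting.remark411_actsOver divisorMonoidQ_isDivisorial α d

/-! ### The span-shaped base category `b ← a → x` -/

/-- The base category of the witness: the span `b ← a → x` (`a := none`, `b := some true`, `x := some false`).
[folklore] -/
abbrev SpanBase : Type := WidePushoutShape Bool

/-- The apex `a` of the span. [folklore] -/
abbrev spanBaseA : SpanBase := none

/-- The foot `b` of the span. [folklore] -/
abbrev spanBaseB : SpanBase := some true

/-- The foot `x` of the span. [folklore] -/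
abbrev spanBaseX : SpanBase := some false

/-- Automorphism groups in the span are trivial. [folklore] -/
private theorem subsingleton_aut_span (A : SpanBase) : Subsingleton (Aut A) :=
  ⟨fun _ _ => Iso.ext (Subsingleton.elim _ _)⟩

/-- There is no arrow `b → x` in the span. [folklore] -/
private theorem isEmpty_hom_span : IsEmpty (spanBaseB ⟶ spanBaseX) :=
  ⟨fun f => by cases f⟩

/-- Arrows in both directions force equality of objects in the span. [folklore] -/
private theorem eq_of_hom_hom_span {A B : SpanBase} (f : A ⟶ B) (g : B ⟶ A) : A = B := by
  cases f
  · rfl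
  · cases g

/-- The span is skeletal. [folklore] -/
private theorem skeletal_span : Skeletal SpanBase := fun _ _ ⟨e⟩ => eq_of_hom_hom_span e.hom e.inv

/-- The trivial [FrdI] category vocabulary on the span. [cite: MochizukiEtTh2009, Def 3.6 p.77] -/
def catVocabSpan : FrdICatStub.{0, 0, 0} SpanBase where
  IsDivisorialOn _ := True
  IsRational _ := True
  IsStrictlyRational _ := True

/-! ### The tempered-Frobenioid interface over the span, with the perfect toy's divisor data -/

/-- **Def 3.6 (ii), span-based inhabitant**: base category the span `b ← a → x` (connected — a wide-pushout shape —
totally epimorphic — thin), structure functor to `D₀ = ∗` constant, `Φ = Φ^{ℝ-log} = ℚ_{≥0}` at every object with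
identity transition maps, `B = ℤ ×_{(ℚ_{≥0})^gp} (ℚ_{≥0})^gp`; (a) `Φ^{bs-fld} = ℚ_{≥0}` `ℚ`-monoprime, (b) the constant `1`
has divisor `𝔭 ≠ 0` — verbatim the perfect toy's clauses (abc-iut-L6-t12, `Sec4NonVacuity.lean`).
[cite: MochizukiEtTh2009, Def 3.6 p.77] -/
def temperedFrobenioidSpan : TemperedFrobenioid realifiedQ SpanBase catVocabSpan where
  isConnected := inferInstance
  isTotallyEpimorphic := ⟨fun f => ⟨fun _ _ _ => Subsingleton.elim _ _⟩⟩
  base := (Functor.const SpanBase).obj ⟨PUnit.unit⟩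
  Φ := ⟨fun _ => ⊤, fun _ _ _ => trivial⟩
  isGroupSaturated A := (isGroupSaturated_iff' _).2 fun _ _ _ _ _ _ => trivial
  isPerfFactorial _ := trivial
  isDivisorialOn := trivial
  isMonoprime_bsFld A := isMonoprime_of_eq_top_nnrat
    (eq_top_iff.2 fun x _ => Submonoid.mem_inf.2 ⟨Submonoid.mem_top x,
      (Subgroup.mem_top (Algebra.GrothendieckGroup.of x) :
        Algebra.GrothendieckGroup.of x ∈
          (⊤ : Subgroup (Algebra.GrothendieckGroup (Multiplicative ℚ≥0))))⟩)
  exists_FΛ_div_ne A := ⟨(Multiplicative.ofAdd (1 : ℤ) : Multiplicative ℤ), trivial,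
    (Multiplicative.ofAdd (1 : ℚ≥0) : Multiplicative ℚ≥0), trivial, (1 : Multiplicative ℚ≥0), trivial,
    fun h => one_ne_zero (Multiplicative.ofAdd.injective h),
    divHomQ_ofAdd_one.trans (by
      change Algebra.GrothendieckGroup.of (M := Multiplicative ℚ≥0) (Multiplicative.ofAdd 1) =
        Algebra.GrothendieckGroup.of (M := Multiplicative ℚ≥0) (Multiplicative.ofAdd 1) /
          Algebra.GrothendieckGroup.of (M := Multiplicative ℚ≥0) 1
      rw [(Algebra.GrothendieckGroup.of (M := Multiplicative ℚ≥0)).map_one, div_one])⟩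

/-- Monoid type `ℤ`. [cite: MochizukiEtTh2009, Def 4.1 p.86] -/
theorem temperedFrobenioidSpan_monoidType : temperedFrobenioidSpan.monoidType = MonoidType.Z := rfl

/-- `Φ = ℚ_{≥0}` is perfect at every object of the span. [cite: MochizukiEtTh2009, Def 4.1 p.86] -/
theorem temperedFrobenioidSpan_isPerfect (A : SpanBaseᵒᵖ) : IsPerfect (temperedFrobenioidSpan.Φ.carrier A) :=
  isPerfect_of_mulEquiv_nnrat (N := ↥(⊤ : Submonoid (Multiplicative ℚ≥0))) Submonoid.topEquiv

/-- `B` is objectwise group-like. [cite: MochizukiEtTh2009, Def 3.6 p.77] -/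
theorem ratFnFunctorSpan_isGroupLike :
    Objectwise (fun M _ => IsGroupLike M) temperedFrobenioidSpan.ratFnFunctor :=
  temperedFrobenioidSpan.ratFnFunctor_isGroupLike realifiedQ.isUnit_BΛ

/-- `Φ = ℚ_{≥0}` is objectwise divisorial. [cite: MochizukiEtTh2009, Def 3.6 p.77] -/
theorem divisorMonoidSpan_isDivisorial :
    Objectwise (fun M _ => IsDivisorial M) temperedFrobenioidSpan.divisorMonoid :=
  fun _ => (isMonoprime_of_eq_top_nnrat (S := (⊤ : Submonoid (Multiplicative ℚ≥0))) rfl).isDivisorial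

/-- `A_⊙ := (a, 0)`, the zero object over the apex of the span. [cite: MochizukiEtTh2009, Def 4.1 p.86] -/
def spanA : temperedFrobenioidSpan.category := ModelFrobenioid.zeroObj _ _ _ spanBaseA

/-- `B := (b, 0)`, the zero object over the foot `b`. [cite: MochizukiEtTh2009, Def 4.1 p.87] -/
def spanB : temperedFrobenioidSpan.category := ModelFrobenioid.zeroObj _ _ _ spanBaseB

/-- `X := (x, 0)`, the zero object over the foot `x` (the Frobenius-trivial test object). [cite: MochizukiEtTh2009, Rmk 4.1.1 p.88] -/
def spanX : temperedFrobenioidSpan.category := ModelFrobenioid.zeroObj _ _ _ spanBaseX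

/-- `(a, 0)` is Frobenius-trivial ([FrdI] Thm 5.2 proof, L1's `isFrobeniusTrivial_zeroObj`). [cite: MochizukiEtTh2009, Def 4.1 p.86] -/
theorem isFrobeniusTrivial_spanA : PreFrobenioid.IsFrobeniusTrivial temperedFrobenioidSpan.toElem spanA :=
  ModelFrobenioid.isFrobeniusTrivial_zeroObj ratFnFunctorSpan_isGroupLike _

/-- `(x, 0)` is Frobenius-trivial. [cite: MochizukiEtTh2009, Rmk 4.1.1 p.88] -/
theorem isFrobeniusTrivial_spanX : PreFrobenioid.IsFrobeniusTrivial temperedFrobenioidSpan.toElem spanX :=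
  ModelFrobenioid.isFrobeniusTrivial_zeroObj ratFnFunctorSpan_isGroupLike _

/-- `α := (1, a → b, 0, 1) : (a, 0) → (b, 0)` — the linear isometry over the leg `a → b`.
[cite: MochizukiEtTh2009, Def 4.1 p.87] -/
def spanα : spanA ⟶ spanB := ModelFrobenioid.zeroHom 1 (WidePushoutShape.Hom.init true)

/-- `ψ := (1, a → x, 0, 1) : (a, 0) → (x, 0)` — the test morphism over the other leg `a → x`.
[cite: MochizukiEtTh2009, Rmk 4.1.1 p.88] -/
def spanψ : spanA ⟶ spanX := ModelFrobenioid.zeroHom 1 (WidePushoutShape.Hom.init false)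

/-- **The §4 setting over the span**, through abc-iut-L2-t9's canonical model constructor `mkOfModelCanonical`
(birational vocabulary, disjoint supports, base-Frobenius pairs FILLED from the model Frobenioid); Galois objects :=
all, `Π^tp_X ↠ Aut_D(−)` := trivial (surjective: automorphism groups of the span are trivial), `(N,H)`-slot := `True`,
`A_⊙ := (a, 0)`. [cite: MochizukiEtTh2009, Def 4.1 p.86] -/
def biKummerSettingSpan : BiKummerSetting temperedGroup realifiedQ SpanBase catVocabSpan :=
  BiKummerSetting.mkOfModelCanonical temperedGroup temperedFrobenioidSpan temperedFrobenioidSpan_monoidType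
    temperedFrobenioidSpan_isPerfect (fun _ => True) (fun _ _ => 1)
    (fun A _ _ => ⟨1, (subsingleton_aut_span A).elim _ _⟩) (fun _ _ _ => True) spanA
    isFrobeniusTrivial_spanA trivial

/-- `(a, 0)` is `μ_1`-saturated: `μ_1 = {1}`. [cite: MochizukiEtTh2009, Def 4.1 p.87] -/
theorem isMuSaturated_spanA_one : biKummerSettingSpan.IsMuSaturated spanA 1 := by
  refine ⟨1, ⟨one_mem _, by rw [PNat.one_coe, pow_one]⟩, by rw [orderOf_one, PNat.one_coe], ?_⟩
  rintro τ ⟨-, hτ⟩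
  rw [PNat.one_coe, pow_one] at hτ
  rw [hτ]
  exact one_mem _

/-- **Def 4.1 (iv)(e) at the span model**: `G = 1`, `α'' = id_{(a,0)}`, `α' = α` arise from the base-Frobenius pair given
by the ZERO SECTION of the model Frobenioid over the (skeletal) span (L1's `ModelFrobenioid.isBaseFrobeniusPair_zero`).
[cite: MochizukiEtTh2009, Def 4.1 p.87] -/
theorem arisesFromBaseFrobeniusPair_spanα :
    temperedFrobenioidSpan.ArisesFromBaseFrobeniusPair (A := spanA) ⊥ (𝟙 spanA) spanα := by
  refine ⟨ModelFrobenioid.zeroPresection _ _ _, ModelFrobenioid.zeroFrobeniusSection _ _ _,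
    ModelFrobenioid.isBaseFrobeniusPair_zero divisorMonoidSpan_isDivisorial ratFnFunctorSpan_isGroupLike
      skeletal_span, fun γ hγ => ?_, ⟨rfl, rfl, rfl, rfl, rfl⟩, ⟨rfl, 1, ?_⟩⟩
  · rw [Subgroup.mem_bot] at hγ
    subst hγ
    exact ⟨rfl, rfl, rfl, rfl, rfl⟩
  · rw [map_one]
    rfl

/-- **`α` is of base-Frobenius type** (Def 4.1 (iv)) with data `G = 1`, `α'' = id`, `α' = α`, `N = deg_Fr(α) = 1`:
(a) `(a,0)` Frobenius-trivial, Galois, `μ_1`-saturated; (b) `1 ⥲ Gal(a/b) = 1`; (c) `id` is a base-identity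
endomorphism of Frobenius type; (d) `α`, a linear isometry, is a pull-back morphism (L1's
`ModelFrobenioid.isPullbackMorphism_of`); (e) `arisesFromBaseFrobeniusPair_spanα`. [cite: MochizukiEtTh2009, Def 4.1 p.87] -/
def baseFrobeniusTypeDataSpan : biKummerSettingSpan.BaseFrobeniusTypeData spanα where
  G := ⊥
  G_le := bot_le
  α₂ := 𝟙 _
  α₁ := spanα
  fac := Category.id_comp _
  isFrobeniusTrivial := isFrobeniusTrivial_spanA
  isGalois := trivial
  isMuSaturated := isMuSaturated_spanA_one
  mapsIsomorphically := by
    refine ⟨fun σ hσ => ?_, fun σ _ τ _ _ => ?_, fun τ _ => ⟨1, (⊥ : Subgroup (Aut spanA)).one_mem, ?_⟩⟩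
    · have hσ' : σ = 1 := hσ
      subst hσ'
      rw [map_one]
      exact one_mem _
    · exact (show σ = 1 from ‹σ ∈ ((⊥ : Subgroup (Aut spanA)) : Set (Aut spanA))›).trans
        (show τ = 1 from ‹τ ∈ ((⊥ : Subgroup (Aut spanA)) : Set (Aut spanA))›).symm
    · exact (subsingleton_aut_span _).elim _ _
  cond_c := ⟨rfl, ⟨ModelFrobenioid.isCoAngular ratFnFunctorSpan_isGroupLike _, rfl⟩,
    show IsIso (𝟙 (ModelFrobenioid.base spanA)) from inferInstance⟩
  cond_d := ModelFrobenioid.isPullbackMorphism_of divisorMonoidSpan_isDivisorial ratFnFunctorSpan_isGroupLike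
    rfl rfl
  cond_e := arisesFromBaseFrobeniusPair_spanα

/-- Hence `α` is of base-Frobenius type. [cite: MochizukiEtTh2009, Def 4.1 p.87] -/
theorem isOfBaseFrobeniusType_spanα : biKummerSettingSpan.IsOfBaseFrobeniusType spanα :=
  ⟨baseFrobeniusTypeDataSpan⟩

/-- The test morphism `ψ : (a,0) → (x,0)` is invariant under `G · μ_N((a,0)) = 1 · μ_1 = 1`.
[cite: MochizukiEtTh2009, Rmk 4.1.1 p.88] -/
theorem spanψ_invariant :
    ∀ γ ∈ baseFrobeniusTypeDataSpan.G ⊔ Subgroup.closure (biKummerSettingSpan.mu spanA (biKummerSettingSpan.degFr spanα)),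
      γ.hom ≫ spanψ = spanψ := by
  intro γ hγ
  have hle : baseFrobeniusTypeDataSpan.G ⊔
      Subgroup.closure (biKummerSettingSpan.mu spanA (biKummerSettingSpan.degFr spanα)) ≤ ⊥ :=
    sup_le bot_le ((Subgroup.closure_le _).2 fun σ hσ => by
      have h1 : σ ^ ((1 : ℕ+) : ℕ) = 1 := hσ.2
      rw [PNat.one_coe, pow_one] at h1
      exact h1)
  have hγ1 : γ = 1 := (Subgroup.mem_bot).1 (hle hγ)
  subst hγ1
  exact Category.id_comp _

/-- **Remark 4.1.1 FAILS at the span setting**: `α : (a,0) → (b,0)` is of base-Frobenius type, the Frobenius-trivial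
test object `(x,0)` receives the `G · μ_N`-invariant morphism `ψ` from `(a,0)`, but no morphism from `(b,0)` — the
base has no arrow `b → x` — so `ψ` does not factor through `α`: `α` is not a categorical quotient among
Frobenius-trivial objects. (Print's verification uses [EtTh] Prop. 3.4 (ii) for the BASE category, a connected
temperoid; the typed setting's base is arbitrary.) [cite: MochizukiEtTh2009, Rmk 4.1.1 p.88] -/
theorem not_remark411_span : ¬ biKummerSettingSpan.Remark411 := by
  intro h
  obtain ⟨-, h2⟩ := h spanα baseFrobeniusTypeDataSpan
  obtain ⟨ψ', -, -⟩ := h2 isFrobeniusTrivial_spanX spanψ spanψ_invariant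
  exact isEmpty_hom_span.false (ModelFrobenioid.baseMap ψ')

/-- … although conjunct (1) holds there (as at every canonical instance with `Φ` divisorial): the failure is exactly
the categorical-quotient conjunct (2). [cite: MochizukiEtTh2009, Rmk 4.1.1 p.88] -/
theorem remark411_actsOver_span_and_not_quotient :
    (∀ {A B : biKummerSettingSpan.C} (α : A ⟶ B) (d : biKummerSettingSpan.BaseFrobeniusTypeData α),
      ∀ γ ∈ d.G ⊔ Subgroup.closure (biKummerSettingSpan.mu A (biKummerSettingSpan.degFr α)), γ.hom ≫ α = α) ∧
    ¬ ∀ ⦃Y : biKummerSettingSpan.C⦄, biKummerSettingSpan.IsFrobeniusTrivial Y → ∀ ψ : spanA ⟶ Y,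
        (∀ γ ∈ baseFrobeniusTypeDataSpan.G ⊔
            Subgroup.closure (biKummerSettingSpan.mu spanA (biKummerSettingSpan.degFr spanα)), γ.hom ≫ ψ = ψ) →
          ∃! ψ' : spanB ⟶ Y, spanα ≫ ψ' = ψ :=
  ⟨fun α d => biKummerSettingSpan.remark411_actsOver divisorMonoidSpan_isDivisorial α d, fun h2 => by
    obtain ⟨ψ', -, -⟩ := h2 isFrobeniusTrivial_spanX spanψ spanψ_invariant
    exact isEmpty_hom_span.false (ModelFrobenioid.baseMap ψ')⟩

end Toy

/-- **The universal closure of Remark 4.1.1 over arbitrary §4 settings is false** (FACT-LIST row F-0729 is a SCHEMA: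
its instance forms must constrain the base category — print: a connected temperoid, [EtTh] Prop. 3.4 (ii); it is never
the hypothesis `∀ S, S.Remark411`): quantified over all settings (universe `0`) it fails at the span setting.
[cite: MochizukiEtTh2009, Rmk 4.1.1 p.88] -/
theorem not_forall_remark411 :
    ¬ ∀ (K : Type) [Field K] (X : SemiGraphs.TemperedArithmeticGroup.{0} K) (D₀ : Type) [Category.{0} D₀]
        (V : FrdIMonoidStub.{0}) (T : RealifiedDivisorMonoids (D₀ := D₀) V) (D : Type) [Category.{0} D]
        (VD : FrdICatStub.{0, 0, 0} D) (S : BiKummerSetting X T D VD), S.Remark411 :=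
  fun h => Toy.not_remark411_span (h _ _ _ _ _ _ _ Toy.biKummerSettingSpan)

/-- **… and it fails even along the canonical model instances** `mkOfModelCanonical` (birational vocabulary and
condition (e) genuinely those of the model Frobenioid): restricting the row to abc-iut-L2-t9's canonical family does
not rescue it — what must be constrained is the base category `D`. [cite: MochizukiEtTh2009, Rmk 4.1.1 p.88] -/
theorem not_forall_remark411_mkOfModelCanonical :
    ¬ ∀ (K : Type) [Field K] (X : SemiGraphs.TemperedArithmeticGroup.{0} K) (D₀ : Type) [Category.{0} D₀]
        (V : FrdIMonoidStub.{0}) (T : RealifiedDivisorMonoids (D₀ := D₀) V) (D : Type) [Category.{0} D]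
        (VD : FrdICatStub.{0, 0, 0} D) (tf : TemperedFrobenioid T D VD) (hZ : tf.monoidType = MonoidType.Z)
        (hP : ∀ A : Dᵒᵖ, IsPerfect (tf.Φ.carrier A)) (IG : D → Prop) (gS : ∀ A : D, IG A → (X.Pi →* Aut A))
        (gSs : ∀ (A : D) (h : IG A), Function.Surjective (gS A h))
        (NH : Subgroup (Field.absoluteGaloisGroup K) → tf.category → ℕ+ → Prop) (A₀ : tf.category)
        (hA₀ : PreFrobenioid.IsFrobeniusTrivial tf.toElem A₀) (hA₀' : IG A₀.base),
        (BiKummerSetting.mkOfModelCanonical X tf hZ hP IG gS gSs NH A₀ hA₀ hA₀').Remark411 :=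
  fun h => Toy.not_remark411_span (h _ _ _ _ _ _ _ _ _ _ _ _ _ _ _ _ _)

end Literature.AnabelianGeometry.EtaleTheta

end
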